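import Summits.QuantumFields.BalabanUV.T4Continuum.Support.NE7ConstrainedPoincareAssembly
import Summits.QuantumFields.BalabanUV.T4Continuum.Support.NE3CovariantSliceOrthogonality

/-!
# NE7LandauDivBound — THE LETTER (H4) OF F215 DISCHARGED: `‖R D_W† v‖² ≤ 4d·dirSq(extF v)` for every skew torus 1-form `v` (`R` = the orthogonal projection `landauProjK`, `D_W†` the adjoint of
# the covariant gradient `gradOpK`): `R` contracts, `‖D_W a‖² ≤ 4d‖a‖²` (each bond of `D_W a` is an `Ad`-twisted difference of two values), `‖D_W† v‖² = ⟪v, D_W D_W† v⟫`, and the carrier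
# norm is dominated by `dirSq`; so F215's (CP_W) now rests on (H1) slice Poincaré on `T_A` and (H2) the Landau correction alone (file 145 of the curved (APE), F216)

Cell `pub-balaban`, rung (B)+1 sub-cell t4, lineage `b2b-balaban-t4-ne7-p1` (CRUX PROVER NE7 #1 = OWNER of row NE7), generation 85; memo
`t4/b2b-balaban-t4-ne7-p1-g85/LAGRANGE-CARRIER.md` §13.
WHY.  F215 `constrainedPoincare_of_pieces` takes three letters; (H4) is elementary lattice analysis and is closed here, leaving the two genuinely row-NE3 letters (H1) (slice Poincaré on
`T_A = ker Q̄_W ∩ ker R D_W†`) and (H2) (Landau correction inside `N(Q′(W))`) between F204's first hypothesis `hpos` and the tree.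
WHAT ([folklore]; 0 def, 0 sorry).  §1 `norm_sq_gradOpK_le` (`‖D_W a‖² ≤ 4d·‖a‖²`, via `NE3CovariantSliceOrthogonality.nhsNormSq_gaugeDir_le` + periodic shifts);
§2 `norm_sq_landauProjK_le` (`‖R w‖² ≤ ‖w‖²`); §3 `norm_sq_le_dirSq` (`‖v‖² ≤ dirSq (extF v)`); §4 `core_H4`, **`landauDiv_sq_le`** ((H4) with `κ = 4d`);
§5 **`constrainedPoincare_of_slice_and_landau`** (F215 with (H4) discharged: (CP_W) ⟸ (H1) ∧ (H2)).
HONEST FRAMING (page 1): (H1), (H2) remain HYPOTHESES — (CP_W), (P_a) NOT proved unconditionally; (KL-B) at curved `W` NOT proved; (APE) on curved data NOT proved; NOT ONE-STEP, NOT NE7;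
spine 0∕9; finite T⁴ rung (B)+1 — NOT infinite volume, NOT mass gap, NOT `BetaPertH`, NOT Clay.  Continuum YM on T⁴ ⇐ BetaPertH ∧ nine spine estimates (0/9 proved); BetaPertH ⇐
(D1) ∧ (D4) ∧ CAP+tail; G-an2-4 gates asym, D1 and NE2/3/4.
-/

set_option autoImplicit false

open scoped BigOperators InnerProductSpace Matrix Matrix.Norms.L2Operator
open Finset

namespace Summit.QuantumFields.BalabanUV.T4Continuum.NE7LandauDivBound

open Literature.MathematicalPhysics.QuantumFieldTheory.Balaban1983to89
open B7Prop1Explicit B7Prop2Explicit UnitaryModel MatrixNorms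
open T4AveragingDeficitWall (IsUnitaryCfg IsSkewDir SmallField dirSq curlSq)
open T4AveragingDeficitWallBoundary (periodBox IsPeriodicCfg sum_periodBox_shift)
open AveragingDeficitPeriodicCounting (IsPeriodicDir)
open AveragingDeficitMultiLevelPrep (LevelSmall)
open AveragingDeficitTwoLevelPrep (prop1Radius)
open SpreadLift (loopRad)
open BlockAveragePushDirGauge (gaugeDir)
open NE3HilbertSchmidtTorus
open NE3.PairLandauB8 (avgKernelGauges)
open NE3QbarIterCovLiftPrep (cruxC liftC)
open NE3RightInverseSolveLetters (thetaLoc)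
open NE3CovariantSliceOrthogonality (nhsNormSq_gaugeDir_le)
open NE7BalabanSoftOperator
open NE7GaugeFixOnPureGauges (resS_mem_of_avgKernel)
open NE7ConstrainedPoincareAssembly (constrainedPoincare_of_pieces)

noncomputable section

variable {d : ℕ} {n : Type*} [Fintype n] [DecidableEq n]

/-! ## §1 `‖D_W a‖² ≤ 4d‖a‖²` -/

/-- **THE COVARIANT GRADIENT IS BOUNDED BY `2√d`**: for unitary `P`-periodic `W` and a skew torus section `a`, `‖D_W a‖² ≤ 4d·‖a‖²`. [folklore] -/
theorem norm_sq_gradOpK_le {W : Site d → Fin d → (Matrix n n ℂ)ˣ} (hWu : IsUnitaryCfg W) {P : ℕ} [NeZero P] (hWP : IsPeriodicCfg W (P : ℤ))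
    (a : skewSecs d n P) :
    ‖gradOpK hWu P a‖ ^ 2 ≤ 4 * d * ‖a‖ ^ 2 := by
  have hP : 1 ≤ P := Nat.one_le_iff_ne_zero.mpr (NeZero.ne _)
  rw [Submodule.coe_norm, Submodule.coe_norm, coe_gradOpK, norm_sq_eq_sum_extF, extF_DW hWP, norm_sq_eq_sum_extS]
  -- bond by bond: `nhsNormSq (D_W S)(x, κ) ≤ 2(nhsNormSq (S x) + nhsNormSq (S (x + e_κ)))`
  have h1 : ∑ x ∈ periodBox (d := d) P, ∑ κ : Fin d, nhsNormSq (gaugeDir W (extS P (a : Sec d n P)) x κ)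
      ≤ ∑ x ∈ periodBox (d := d) P, ∑ κ : Fin d, 2 * (nhsNormSq (extS P (a : Sec d n P) x) + nhsNormSq (extS P (a : Sec d n P) (x + e κ))) :=
    Finset.sum_le_sum fun x _ => Finset.sum_le_sum fun κ _ => nhsNormSq_gaugeDir_le hWu _ x κ
  -- periodic shift of the second summand
  have hshift : ∀ κ : Fin d, ∑ x ∈ periodBox (d := d) P, nhsNormSq (extS P (a : Sec d n P) (x + e κ))
      = ∑ x ∈ periodBox (d := d) P, nhsNormSq (extS P (a : Sec d n P) x) :=
    fun κ => sum_periodBox_shift P hP (g := fun x => nhsNormSq (extS P (a : Sec d n P) x)) (fun x τ => by simp only [extS_add_period]) (e κ)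
  have hκ : ∀ κ : Fin d, ∑ x ∈ periodBox (d := d) P, 2 * (nhsNormSq (extS P (a : Sec d n P) x) + nhsNormSq (extS P (a : Sec d n P) (x + e κ)))
      = 4 * ∑ x ∈ periodBox (d := d) P, nhsNormSq (extS P (a : Sec d n P) x) := by
    intro κ
    simp only [mul_add, Finset.sum_add_distrib, ← Finset.mul_sum, hshift κ]
    ring
  have h2 : ∑ x ∈ periodBox (d := d) P, ∑ κ : Fin d, 2 * (nhsNormSq (extS P (a : Sec d n P) x) + nhsNormSq (extS P (a : Sec d n P) (x + e κ)))
      = 4 * d * ∑ x ∈ periodBox (d := d) P, nhsNormSq (extS P (a : Sec d n P) x) := by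
    rw [Finset.sum_comm, Finset.sum_congr rfl fun κ _ => hκ κ, Finset.sum_const, Finset.card_univ, Fintype.card_fin, nsmul_eq_mul]
    ring
  linarith [h1, h2.le, h2.ge]

/-! ## §2 The Landau projection contracts -/

/-- `‖R w‖² ≤ ‖w‖²` for the orthogonal projection `R = landauProjK`. [folklore] -/
theorem norm_sq_landauProjK_le (L N k : ℕ) [NeZero (N * L ^ k)] (W : Site d → Fin d → (Matrix n n ℂ)ˣ) (w : skewSecs d n (N * L ^ k)) :
    ‖landauProjK L N k W w‖ ^ 2 ≤ ‖w‖ ^ 2 := by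
  have h1 : ‖landauProjK L N k W w‖ ^ 2 = ⟪w, landauProjK L N k W w⟫_ℝ := by
    rw [← real_inner_self_eq_norm_sq, inner_landauProjK_left, landauProjK_idem]
  have h2 : ⟪w, landauProjK L N k W w⟫_ℝ ≤ ‖w‖ * ‖landauProjK L N k W w‖ := real_inner_le_norm _ _
  nlinarith [h1, h2, norm_nonneg w, norm_nonneg (landauProjK L N k W w), sq_nonneg (‖landauProjK L N k W w‖ - ‖w‖)]

/-! ## §3 The carrier norm against `dirSq` -/

/-- `‖v‖² ≤ dirSq (extF v) (periodBox P)` (normalised Hilbert–Schmidt against operator squares). [folklore] -/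
theorem norm_sq_le_dirSq {P : ℕ} [NeZero P] (v : skewForms d n P) :
    ‖v‖ ^ 2 ≤ dirSq (extF P (v : Form d n P)) (periodBox (d := d) P) := by
  rw [Submodule.coe_norm, norm_sq_eq_sum_extF]
  unfold dirSq
  exact Finset.sum_le_sum fun x _ => Finset.sum_le_sum fun κ _ => nhsNormSq_le_opNorm_sq _

/-! ## §4 (H4): `‖R D_W† v‖² ≤ 4d·dirSq (extF v)` -/

/-- The real-number core of §4: `x² = ip ≤ y·z`, `z² ≤ 4δ·x²`, `r² ≤ x²`, `y² ≤ D` ⟹ `r² ≤ 4δ·D`. [folklore] -/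
theorem core_H4 {x y z ip r D δ : ℝ} (hx0 : 0 ≤ x) (hy0 : 0 ≤ y) (hz0 : 0 ≤ z) (hδ : 0 ≤ δ)
    (hadj : x ^ 2 = ip) (hCS : ip ≤ y * z) (hD : z ^ 2 ≤ 4 * δ * x ^ 2) (hR : r ^ 2 ≤ x ^ 2) (hv : y ^ 2 ≤ D) :
    r ^ 2 ≤ 4 * δ * D := by
  have hx2 : x ^ 2 ≤ 4 * δ * y ^ 2 := by
    by_cases h0 : x = 0
    · rw [h0]; nlinarith [sq_nonneg y]
    · have hxpos : 0 < x := lt_of_le_of_ne hx0 (Ne.symm h0)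
      have h1 : x ^ 2 ≤ y * z := hadj ▸ hCS
      have h3 : x ^ 2 * x ^ 2 ≤ (y * z) * (y * z) := mul_le_mul h1 h1 (sq_nonneg x) (mul_nonneg hy0 hz0)
      have h4 : (y * z) * (y * z) ≤ y ^ 2 * (4 * δ * x ^ 2) := by
        have := mul_le_mul_of_nonneg_left hD (sq_nonneg y)
        nlinarith [this]
      have h5 : x ^ 2 * x ^ 2 ≤ (4 * δ * y ^ 2) * x ^ 2 := by nlinarith [h3, h4]
      exact le_of_mul_le_mul_right h5 (by positivity)
  have h6 : 4 * δ * y ^ 2 ≤ 4 * δ * D := mul_le_mul_of_nonneg_left hv (by positivity)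
  linarith [hR, hx2, h6]

/-- **(H4) OF F215**: for unitary `P`-periodic `W` (`P = N·L^k`) and every skew torus 1-form `v`, `⟪R D† v, R D† v⟫ ≤ 4d·dirSq (extF v) (periodBox P)`. [folklore] -/
theorem landauDiv_sq_le {L N k : ℕ} [NeZero (N * L ^ k)] {W : Site d → Fin d → (Matrix n n ℂ)ˣ} (hWu : IsUnitaryCfg W)
    (hWP : IsPeriodicCfg W ((N * L ^ k : ℕ) : ℤ)) (v : skewForms d n (N * L ^ k)) :
    ⟪landauProjK L N k W
        ((LinearMap.adjoint (𝕜 := ℝ) (E := skewSecs d n (N * L ^ k)) (F := skewForms d n (N * L ^ k)) (gradOpK hWu (N * L ^ k))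
          : skewForms d n (N * L ^ k) →ₗ[ℝ] skewSecs d n (N * L ^ k)) v),
      landauProjK L N k W
        ((LinearMap.adjoint (𝕜 := ℝ) (E := skewSecs d n (N * L ^ k)) (F := skewForms d n (N * L ^ k)) (gradOpK hWu (N * L ^ k))
          : skewForms d n (N * L ^ k) →ₗ[ℝ] skewSecs d n (N * L ^ k)) v)⟫_ℝ
      ≤ 4 * (d : ℝ) * dirSq (extF (N * L ^ k) (v : Form d n (N * L ^ k))) (periodBox (d := d) (N * L ^ k)) := by
  rw [real_inner_self_eq_norm_sq]
  have hR := norm_sq_landauProjK_le L N k W ((LinearMap.adjoint (𝕜 := ℝ) (E := skewSecs d n (N * L ^ k)) (F := skewForms d n (N * L ^ k)) (gradOpK hWu (N * L ^ k))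
        : skewForms d n (N * L ^ k) →ₗ[ℝ] skewSecs d n (N * L ^ k)) v)
  have hv := norm_sq_le_dirSq v
  have hD := norm_sq_gradOpK_le hWu hWP ((LinearMap.adjoint (𝕜 := ℝ) (E := skewSecs d n (N * L ^ k)) (F := skewForms d n (N * L ^ k)) (gradOpK hWu (N * L ^ k))
        : skewForms d n (N * L ^ k) →ₗ[ℝ] skewSecs d n (N * L ^ k)) v)
  have hadj : ‖((LinearMap.adjoint (𝕜 := ℝ) (E := skewSecs d n (N * L ^ k)) (F := skewForms d n (N * L ^ k)) (gradOpK hWu (N * L ^ k))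
        : skewForms d n (N * L ^ k) →ₗ[ℝ] skewSecs d n (N * L ^ k)) v)‖ ^ 2 = ⟪v, gradOpK hWu (N * L ^ k) ((LinearMap.adjoint (𝕜 := ℝ) (E := skewSecs d n (N * L ^ k)) (F := skewForms d n (N * L ^ k)) (gradOpK hWu (N * L ^ k))
        : skewForms d n (N * L ^ k) →ₗ[ℝ] skewSecs d n (N * L ^ k)) v)⟫_ℝ := by
    rw [← real_inner_self_eq_norm_sq]; exact LinearMap.adjoint_inner_left _ _ _
  have hCS := real_inner_le_norm v (gradOpK hWu (N * L ^ k) ((LinearMap.adjoint (𝕜 := ℝ) (E := skewSecs d n (N * L ^ k)) (F := skewForms d n (N * L ^ k)) (gradOpK hWu (N * L ^ k))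
        : skewForms d n (N * L ^ k) →ₗ[ℝ] skewSecs d n (N * L ^ k)) v))
  exact core_H4 (norm_nonneg _) (norm_nonneg _) (norm_nonneg _) (Nat.cast_nonneg d) hadj hCS hD hR hv

/-! ## §5 F215 with (H4) discharged -/

section Carrier

variable [Nonempty n] {L N : ℕ} [NeZero N] (hL : 1 ≤ L) (hL2 : 2 ≤ L) (j : ℕ) [NeZero (N * L ^ (j + 1))]
  {W : Site d → Fin d → (Matrix n n ℂ)ˣ} {x : ℝ} (hWu : IsUnitaryCfg W) (hWP : IsPeriodicCfg W ((N * L ^ (j + 1) : ℕ) : ℤ))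
  (hx : 0 ≤ x) (hs : LevelSmall d L j x) (hWx : SmallField W x)
  (hθ : cruxC d L * (((L : ℝ) ^ (j + 1)) ^ 2 * x) < 1) (hθl : thetaLoc d L * (((L : ℝ) ^ (j + 1)) ^ 2 * x) < 1) (hd : 1 ≤ d)

set_option maxHeartbeats 400000 in
include hL2 hWP hθ hθl hd in
/-- **(CP_W) FROM (H1) AND (H2)**: F215's `constrainedPoincare_of_pieces` with its letter (H4) supplied by `landauDiv_sq_le` (`κ = 4d`). [folklore] -/
theorem constrainedPoincare_of_slice_and_landau {η : ℝ} (hWη : SmallField W η)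
    (hsmall : 8 * d * (((L : ℝ) ^ (j + 1)) * (((d : ℝ) - 1) * (((L : ℝ) ^ (j + 1)) - 1) * x)) ^ 2
      + 2 * (Fintype.card n * (4 * (d : ℝ) ^ 2 * ((L : ℝ) ^ (j + 1) - 1) ^ 2 * x + 16 * d * loopRad d L ((prop1Radius d L)^[j] x)) ^ 2) ≤ 1 / 2)
    {CT : ℝ} (hCT : 0 ≤ CT)
    (H1 : ∀ t : skewForms d n (N * L ^ (j + 1)), qbarOpK (N := N) hL j hWu hx hs hWx t = 0 →
      landauProjK L N (j + 1) W
          ((LinearMap.adjoint (𝕜 := ℝ) (E := skewSecs d n (N * L ^ (j + 1))) (F := skewForms d n (N * L ^ (j + 1))) (gradOpK hWu (N * L ^ (j + 1)))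
            : skewForms d n (N * L ^ (j + 1)) →ₗ[ℝ] skewSecs d n (N * L ^ (j + 1))) t) = 0 →
      dirSq (extF (N * L ^ (j + 1)) (t : Form d n (N * L ^ (j + 1)))) (periodBox (d := d) (N * L ^ (j + 1)))
        ≤ CT * curlSq W (extF (N * L ^ (j + 1)) (t : Form d n (N * L ^ (j + 1)))) (periodBox (d := d) (N * L ^ (j + 1))))
    (H2 : ∀ b' : skewForms d n (N * L ^ (j + 1)), qbarOpK (N := N) hL j hWu hx hs hWx b' = 0 →
      ∃ μ : Site d → Matrix n n ℂ, ∃ hμ : μ ∈ avgKernelGauges (d := d) (n := n) L N (j + 1) W,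
        landauProjK L N (j + 1) W
          ((LinearMap.adjoint (𝕜 := ℝ) (E := skewSecs d n (N * L ^ (j + 1))) (F := skewForms d n (N * L ^ (j + 1))) (gradOpK hWu (N * L ^ (j + 1)))
            : skewForms d n (N * L ^ (j + 1)) →ₗ[ℝ] skewSecs d n (N * L ^ (j + 1)))
            (b' - gradOpK hWu (N * L ^ (j + 1)) ⟨resS (N * L ^ (j + 1)) μ, resS_mem_of_avgKernel hμ⟩)) = 0 ∧
        qbarOpK (N := N) hL j hWu hx hs hWx (gradOpK hWu (N * L ^ (j + 1)) ⟨resS (N * L ^ (j + 1)) μ, resS_mem_of_avgKernel hμ⟩) = 0)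
    (b : skewForms d n (N * L ^ (j + 1))) :
    dirSq (extF (N * L ^ (j + 1)) (b : Form d n (N * L ^ (j + 1)))) (periodBox (d := d) (N * L ^ (j + 1)))
      ≤ (9 * CT * (Fintype.card n : ℝ)
            + 2 * (4 * Fintype.card n * ((L : ℝ) ^ (j + 1)) ^ 2)
              * (9 * CT * (16 * Fintype.card n * (Fintype.card (T4AveragingDeficitWall.Plane d)) * η ^ 2 * ((L : ℝ) ^ (j + 1)) ^ 2) + 3))
          * (curlSq W (extF (N * L ^ (j + 1)) (b : Form d n (N * L ^ (j + 1)))) (periodBox (d := d) (N * L ^ (j + 1))) / (Fintype.card n : ℝ)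
              + ⟪landauProjK L N (j + 1) W
                  ((LinearMap.adjoint (𝕜 := ℝ) (E := skewSecs d n (N * L ^ (j + 1))) (F := skewForms d n (N * L ^ (j + 1))) (gradOpK hWu (N * L ^ (j + 1)))
                    : skewForms d n (N * L ^ (j + 1)) →ₗ[ℝ] skewSecs d n (N * L ^ (j + 1))) b),
                 landauProjK L N (j + 1) W
                  ((LinearMap.adjoint (𝕜 := ℝ) (E := skewSecs d n (N * L ^ (j + 1))) (F := skewForms d n (N * L ^ (j + 1))) (gradOpK hWu (N * L ^ (j + 1)))
                    : skewForms d n (N * L ^ (j + 1)) →ₗ[ℝ] skewSecs d n (N * L ^ (j + 1))) b)⟫_ℝ)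
        + ((2 * (4 * Fintype.card n * ((L : ℝ) ^ (j + 1)) ^ 2) * (4 * (d : ℝ))
              * (9 * CT * (16 * Fintype.card n * (Fintype.card (T4AveragingDeficitWall.Plane d)) * η ^ 2 * ((L : ℝ) ^ (j + 1)) ^ 2) + 3)
              + 144 * (d : ℝ) * CT + 3)
            * (Fintype.card n * ((liftC d / (1 - thetaLoc d L * (((L : ℝ) ^ (j + 1)) ^ 2 * x))) ^ 2 * (((L : ℝ) ^ (j + 1)) ^ d / ((L : ℝ) ^ (j + 1)) ^ 2))))
          * ⟪qbarOpK (N := N) hL j hWu hx hs hWx b, qbarOpK (N := N) hL j hWu hx hs hWx b⟫_ℝ :=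
  constrainedPoincare_of_pieces (N := N) hL hL2 j hWu hWP hx hs hWx hθ hθl hd hWη hsmall hCT H1 H2 (by positivity)
    (fun v => landauDiv_sq_le hWu hWP v) b

end Carrier

end

end Summit.QuantumFields.BalabanUV.T4Continuum.NE7LandauDivBound
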